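import Literature.MathematicalPhysics.QuantumLattice.TorusSectorPressureTypeBoundAllTori
import Literature.MathematicalPhysics.QuantumLattice.HubbardTorusTTPrimeMarkovPressureClusterBound
import Literature.MathematicalPhysics.QuantumLattice.HubbardThermalAxisWindow
import HarnessLib

/-!
# Thermal energy windows at `t' ≠ 0` from a C2 (type-class) certificate and a `t–t'` rectangle Markov (C1)
# certificate — every torus limit

Family `hubbard` (topic `MathematicalPhysics/QuantumLattice`); the `t' ≠ 0` (cuprate-box) companion of
`HubbardThermalAxisWindowAllTori`. The C2 floor `W = (q log q − Σ m_s log m_s + Σ m_s log z_s)/(q a b)` from certified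
open-box data of the `t–t'` model holds along every `Ls → ∞`
(`InfVolFermionState.eventually_typeFreeEntropy_mul_sq_le_log_partitionFn_allTori`); the `t–t'` rectangle Markov
certificate (`HubbardTorusTTPrimeMarkovPressureClusterBound`, corner representative `cornerEnergyRepTT'` with the two
diagonal bonds of the corner block) gives the eventual pressure CEILING `c − β' μ n`
(`eventually_log_partitionFn_sectorHamiltonianTT'_le_of_clusterCertificateTT'`). The two chords of
`HubbardThermalAxisWindow` §1 then word the thermal energy of EVERY torus limit of the canonical sector Gibbs states
of `hubbardTorusTT' L t t' U`:

* `IsTorusLimitOfMixture.meanEnergy_hubbardTTPrime_le_of_typeClass_of_rectMarkovCertificateTT'_allTori` — upper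
  edge `e_Φ(ω) ≤ ((c − β_h μ n) − W)/(β − β_h)` (C1 at `β_h < β`);
* `IsTorusLimitOfMixture.le_meanEnergy_hubbardTTPrime_of_typeClass_of_rectMarkovCertificateTT'_allTori` — lower
  edge `(W − (c − β_c μ n))/(β_c − β) ≤ e_Φ(ω)` (C1 at `β_c > β`).

Everything is PROVED; no definition, no named fact.

## References

* R. B. Israel, *Convexity in the Theory of Lattice Gases* (1979), Lemma II.3.1. [cite: Israel1979, Lemma II.3.1]
* D. Poulin, M. B. Hastings, Phys. Rev. Lett. 106 (2011) 080403, eqs. (3)–(8). [cite: PoulinHastings2011, eqs. (3)–(8)]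
* D. Ruelle, *Statistical Mechanics: Rigorous Results* (1969), §3.3. [cite: Ruelle1969, §3.3]
* H. Xu et al. (2024), eq. (1) (the `t–t'` Hubbard model of the cuprates). [cite: XuEtAl2024, eq. (1)]
-/

noncomputable section

namespace Literature.MathematicalPhysics.QuantumLattice

open Matrix Finset HubbardWave0 ThermodynamicLimit LiebThm1 AndersonCluster Literature.Probability.LatticeModels
open _root_.Filter
open scoped _root_.Topology ComplexOrder BigOperators

namespace InfVolFermionState

variable {t t' U n β : ℝ} {ω : InfVolFermionState 2} {Ls : ℕ → ℕ}

/-- **Upper edge at `t' ≠ 0` from C2 at `β` and a `t–t'` rectangle C1 certificate at `β_h < β`, every torus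
limit.** C2: box `a × b`, sectors `S`, balanced base type `m` supported in `S` (`Σ m = q ≥ 1`,
`Σ m_s a_s = Σ m_s b_s = A₀`), density `n (qab) = 2A₀` (`0 ≤ n ≤ 2`), floors `0 < z_s ≤ Re Z_β(H^open_{a×b}(t,t',U); s)`;
`ω` a torus limit of the canonical sector Gibbs states of `hubbardTorusTT' L t t' U` at `β` along ANY `Ls → ∞`.
C1: rectangle `a' × b'` (`a', b' ≥ 2`) at `(β_h, μ)`, structured annihilator, dual `L_B`, constant `c`
(`cornerEnergyRepTT'`). Then `e_Φ(ω) ≤ ((c − β_h μ n) − W)/(β − β_h)`.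
[cite: Israel1979, Lemma II.3.1] [cite: PoulinHastings2011, eqs. (3)–(8)] [cite: Ruelle1969, §3.3] -/
theorem IsTorusLimitOfMixture.meanEnergy_hubbardTTPrime_le_of_typeClass_of_rectMarkovCertificateTT'_allTori
    (hn0 : 0 ≤ n) (hn2 : n ≤ 2)
    (h : ω.IsTorusLimitOfMixture (sectorGibbsCount n) (fun L => sectorGibbsWeightTT' β t t' U n L)
      (fun L => sectorGibbsVectorTT' t t' U n L) Ls)
    (hLs : Tendsto Ls atTop atTop) {βh : ℝ} (hβh : 0 < βh) (hlt : βh < β)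
    -- C2 at `β`
    {a b : ℕ} (ha : 1 ≤ a) (hb : 1 ≤ b) (S : Finset (ℕ × ℕ)) (m : ℕ × ℕ → ℕ) {q A₀ : ℕ} (hq : 1 ≤ q)
    (hmS : ∀ s, m s ≠ 0 → s ∈ S) (hsum : ∑ s ∈ S, m s = q) (hA : ∑ s ∈ S, m s * s.1 = A₀)
    (hB : ∑ s ∈ S, m s * s.2 = A₀) (hn : n * ((q : ℝ) * a * b) = 2 * A₀) {z : ℕ × ℕ → ℝ}
    (hz0 : ∀ s ∈ S, 0 < z s)
    (hz : ∀ s ∈ S, z s ≤ (partitionFn β (spinSectorHamiltonian s.1 s.2 (hubbardOpenBoxTT' a b t t' U))).re)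
    -- C1 (`t–t'` rectangle) at `βh`
    (μ : ℝ) {a' b' : ℕ} (ha' : 2 ≤ a') (hb' : 2 ≤ b')
    {ι : Type*} (sι : Finset ι) (Sw : ι → Finset (Site 2)) (hS : ∀ i, Sw i ⊆ rectWindow a' b') (zw : ι → Site 2)
    (hzw : ∀ i, shiftSet (zw i) (Sw i) ⊆ rectWindow a' b') {O : ∀ i, FermionOp (Sw i)}
    (hO : ∀ i ∈ sι, (O i).IsHermitian) (g : ι → ℝ)
    {LB : FermionOp ((rectWindow a' b').erase (mkSite2 (a' - 1) (b' - 1)))} (hLB : LB.IsHermitian) {c : ℝ}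
    (hcert : ((Real.exp c : ℂ) • cfc Real.exp LB -
      fermionPartialTrace (PolySite.incl (Finset.erase_subset (mkSite2 (a' - 1) (b' - 1)) (rectWindow a' b')))
        (cfc Real.exp (-((βh : ℂ) • (cornerEnergyRepTT' (rectWindow a' b') (mkSite2 (a' - 1) (b' - 1)) t t' U μ +
            windowAnnihilator sι (rectWindow a' b') Sw hS zw hzw O g)) +
          fermionEmbed (PolySite.incl (Finset.erase_subset (mkSite2 (a' - 1) (b' - 1)) (rectWindow a' b'))) LB))).PosSemidef) :
    ω.meanEnergy (hubbardTTPrimeFermionInteraction t t' U) 1 ≤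
      ((c - βh * μ * n) - ((q : ℝ) * Real.log q - ∑ s ∈ S, (m s : ℝ) * Real.log (m s) +
        ∑ s ∈ S, (m s : ℝ) * Real.log (z s)) / ((q : ℝ) * a * b)) / (β - βh) := by
  have hβ : 0 ≤ β := (hβh.trans hlt).le
  have hA' := rectCorner_mem_rectWindow (a := a') (b := b') (by omega) (by omega)
  refine h.meanEnergy_hubbardTTPrime_le_of_eventually_pressure_bounds hn0 hn2 hLs hβh hlt
    (fun ε hε => eventually_typeFreeEntropy_mul_sq_le_log_partitionFn_allTori t t' U n hβ ha hb S m hq hmS hsum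
      hA hB hn hn2 hz0 hz hLs hε)
    (fun ε hε => ?_)
  exact eventually_log_partitionFn_sectorHamiltonianTT'_le_of_clusterCertificateTT' t t' U μ βh hn0 hn2 hLs hA'
    toLex_le_toLex_rectCorner (rectWindow_subset_halfOpenBox_max a' b')
    (fun i => bondWeightSum_cornerBondWeight hA' (rectCorner_sub_unitVec_mem_rectWindow ha' hb' i))
    (diagBondWeightSum_cornerDiagBondWeight hA' (rectCorner_sub_unitVec_mem_rectWindow ha' hb' 0)
      (rectCorner_sub_unitVec_mem_rectWindow ha' hb' 1) (rectCorner_sub_unitVec_sub_unitVec_mem_rectWindow ha' hb'))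
    (siteWeightSum_cornerSiteWeight hA') (siteWeightSum_mul_cornerSiteWeight hA' (-μ))
    (isHermitian_windowAnnihilator sι _ Sw hS zw hzw hO g)
    (fun L _ hL3 hℓL => trace_window_mul_windowAnnihilator
      (relabel_translate_gibbsDensity L (relabel_translate_hubbardTorusTT'_sub_mu (L := L) t t' U μ) βh)
      _ sι Sw hS zw hzw O g) hLB hcert hε

/-- **Lower edge at `t' ≠ 0` from C2 at `β` and a `t–t'` rectangle C1 certificate at a colder `β_c > β`, every
torus limit** (same data, C1 at `(β_c, μ)`): `(W − (c − β_c μ n))/(β_c − β) ≤ e_Φ(ω)`.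
[cite: Israel1979, Lemma II.3.1] [cite: PoulinHastings2011, eqs. (3)–(8)] [cite: Ruelle1969, §3.3] -/
theorem IsTorusLimitOfMixture.le_meanEnergy_hubbardTTPrime_of_typeClass_of_rectMarkovCertificateTT'_allTori
    (hn0 : 0 ≤ n) (hn2 : n ≤ 2)
    (h : ω.IsTorusLimitOfMixture (sectorGibbsCount n) (fun L => sectorGibbsWeightTT' β t t' U n L)
      (fun L => sectorGibbsVectorTT' t t' U n L) Ls)
    (hLs : Tendsto Ls atTop atTop) (hβ : 0 < β) {βc : ℝ} (hlt : β < βc)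
    -- C2 at `β`
    {a b : ℕ} (ha : 1 ≤ a) (hb : 1 ≤ b) (S : Finset (ℕ × ℕ)) (m : ℕ × ℕ → ℕ) {q A₀ : ℕ} (hq : 1 ≤ q)
    (hmS : ∀ s, m s ≠ 0 → s ∈ S) (hsum : ∑ s ∈ S, m s = q) (hA : ∑ s ∈ S, m s * s.1 = A₀)
    (hB : ∑ s ∈ S, m s * s.2 = A₀) (hn : n * ((q : ℝ) * a * b) = 2 * A₀) {z : ℕ × ℕ → ℝ}
    (hz0 : ∀ s ∈ S, 0 < z s)
    (hz : ∀ s ∈ S, z s ≤ (partitionFn β (spinSectorHamiltonian s.1 s.2 (hubbardOpenBoxTT' a b t t' U))).re)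
    -- C1 (`t–t'` rectangle) at `βc`
    (μ : ℝ) {a' b' : ℕ} (ha' : 2 ≤ a') (hb' : 2 ≤ b')
    {ι : Type*} (sι : Finset ι) (Sw : ι → Finset (Site 2)) (hS : ∀ i, Sw i ⊆ rectWindow a' b') (zw : ι → Site 2)
    (hzw : ∀ i, shiftSet (zw i) (Sw i) ⊆ rectWindow a' b') {O : ∀ i, FermionOp (Sw i)}
    (hO : ∀ i ∈ sι, (O i).IsHermitian) (g : ι → ℝ)
    {LB : FermionOp ((rectWindow a' b').erase (mkSite2 (a' - 1) (b' - 1)))} (hLB : LB.IsHermitian) {c : ℝ}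
    (hcert : ((Real.exp c : ℂ) • cfc Real.exp LB -
      fermionPartialTrace (PolySite.incl (Finset.erase_subset (mkSite2 (a' - 1) (b' - 1)) (rectWindow a' b')))
        (cfc Real.exp (-((βc : ℂ) • (cornerEnergyRepTT' (rectWindow a' b') (mkSite2 (a' - 1) (b' - 1)) t t' U μ +
            windowAnnihilator sι (rectWindow a' b') Sw hS zw hzw O g)) +
          fermionEmbed (PolySite.incl (Finset.erase_subset (mkSite2 (a' - 1) (b' - 1)) (rectWindow a' b'))) LB))).PosSemidef) :
    (((q : ℝ) * Real.log q - ∑ s ∈ S, (m s : ℝ) * Real.log (m s) + ∑ s ∈ S, (m s : ℝ) * Real.log (z s)) /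
        ((q : ℝ) * a * b) - (c - βc * μ * n)) / (βc - β) ≤
      ω.meanEnergy (hubbardTTPrimeFermionInteraction t t' U) 1 := by
  have hA' := rectCorner_mem_rectWindow (a := a') (b := b') (by omega) (by omega)
  refine h.le_meanEnergy_hubbardTTPrime_of_eventually_pressure_bounds hn0 hn2 hLs hβ hlt
    (fun ε hε => eventually_typeFreeEntropy_mul_sq_le_log_partitionFn_allTori t t' U n hβ.le ha hb S m hq hmS
      hsum hA hB hn hn2 hz0 hz hLs hε)
    (fun ε hε => ?_)
  exact eventually_log_partitionFn_sectorHamiltonianTT'_le_of_clusterCertificateTT' t t' U μ βc hn0 hn2 hLs hA'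
    toLex_le_toLex_rectCorner (rectWindow_subset_halfOpenBox_max a' b')
    (fun i => bondWeightSum_cornerBondWeight hA' (rectCorner_sub_unitVec_mem_rectWindow ha' hb' i))
    (diagBondWeightSum_cornerDiagBondWeight hA' (rectCorner_sub_unitVec_mem_rectWindow ha' hb' 0)
      (rectCorner_sub_unitVec_mem_rectWindow ha' hb' 1) (rectCorner_sub_unitVec_sub_unitVec_mem_rectWindow ha' hb'))
    (siteWeightSum_cornerSiteWeight hA') (siteWeightSum_mul_cornerSiteWeight hA' (-μ))
    (isHermitian_windowAnnihilator sι _ Sw hS zw hzw hO g)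
    (fun L _ hL3 hℓL => trace_window_mul_windowAnnihilator
      (relabel_translate_gibbsDensity L (relabel_translate_hubbardTorusTT'_sub_mu (L := L) t t' U μ) βc)
      _ sι Sw hS zw hzw O g) hLB hcert hε

end InfVolFermionState

end Literature.MathematicalPhysics.QuantumLattice

end
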